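import Mathlib.Analysis.Calculus.Deriv.Mul
import Mathlib.Analysis.Calculus.Deriv.Add
import Mathlib.Analysis.Calculus.MeanValue
import Mathlib.LinearAlgebra.Dual.Lemmas
import Literature.NumberTheory.Automorphic.GKModuleTensor
import Literature.NumberTheory.Automorphic.GKModulesSmoothVectorsProofs
import HarnessLib

/-!
# `Ad`-compatibility of a `(𝔤, K)`-module is automatic when `K` is generated by `exp 𝔨`

Topic `NumberTheory/Automorphic`; namespace `Literature.NumberTheory.Automorphic.IsGKModule` (companion to `GKModules`,
`GKModulesOneParameter`, `GKModuleOfDifferentiableRep`).  Theorems only: no definition, no named fact, no `sorry`.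

Of the four `(𝔤, K)`-module axioms `IsGKModule G ρK ρ𝔤` (Wallach §3.3.1; Borel–Wallach 0 §2.5: `kFinite`, `weaklyContinuous`,
`hasWeakDeriv` = "`d/dt|₀ ℓ (ρK (exp tY) v) = ℓ (ρ𝔤 Y v)` for `Y ∈ 𝔨`", `ad_compat` = "`ρK k ∘ ρ𝔤 X ∘ ρK k⁻¹ = ρ𝔤 (Ad k X)`"),
the last is automatic for a representation of ALL of `G` (`IsDifferentiableRep.conj_dτ`), but for a `K`-action alone it is a
genuine identity between `ρ𝔤|𝔭` and `ρK`.  This file proves that it FOLLOWS from the other three on the subgroup of `K` generated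
by `exp 𝔨` — hence on all of `K` whenever `K = ⟨exp 𝔨⟩` (e.g. `K = U(p) × U(q) ⊂ U(p,q)`, where even `K = exp 𝔨`,
`BorelWallach2000/UpqMaximalCompactExp`):

* `hasDerivAt_conjCoeff_zero` — for `Y ∈ 𝔨`, `X ∈ 𝔤`, `s ↦ ℓ (ρK (exp sY)⁻¹ (ρ𝔤 (Ad (exp sY) X) (ρK (exp sY) v)))` has
  derivative `ℓ ((ρ𝔤 X ρ𝔤 Y + ρ𝔤 ⁅Y, X⁆ − ρ𝔤 Y ρ𝔤 X) v) = 0` at `0` (product rule in coordinates of the finite-dimensional,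
  `K`- hence `𝔨`-stable `K`-span of `v` and of `𝔤`; `ρ𝔤` is a Lie homomorphism);
* `conjCoeff_eq` — by the one-parameter group law the derivative vanishes everywhere, so
  `ρK (exp Y)⁻¹ ∘ ρ𝔤 (Ad (exp Y) X) ∘ ρK (exp Y) = ρ𝔤 X`; `ad_compat_expK`;
* `ad_compat_of_mem_closure_expK` — the good `k` form a subgroup (`Ad (k k') = Ad k ∘ Ad k'`);
* **`of_hasWeakDeriv`** (`Subgroup.closure (range expK) = ⊤`) and **`of_hasWeakDeriv_of_expK_surjective`** (every `k` an
  exponential): `kFinite`, `weaklyContinuous`, `hasWeakDeriv` alone give `IsGKModule G ρK ρ𝔤`.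

This is the standard remark that for connected `K` condition 1) of Borel–Wallach 0 §2.5 follows from 2) and the `𝔤`-module
structure. [cite: BorelWallach2000, 0 §2.5] [cite: KnappVogan1995, §I.4 (1.64)–(1.65)]

Search: tree `IsGKModule`, `RealMatrixGroup.expK`/`Ad`, `expK_add_smul` (`GKModulesOneParameter`), `Ad_one`/`Ad_mul`
(`GKCohomology`), `GKTensor.kOrbitSpan_stable` (`GKModuleTensor`), `expS`, `AdCLM`, `ExpOrbit.basisS`/`coordS`, `brS`, `hasDerivAt_AdCLM_expS_smul` (`GKModulesSmoothVectorsProofs`);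
Mathlib `HasDerivAt.fun_sum/fun_mul/fun_smul`, `is_const_of_deriv_eq_zero`, `Subspace.dualLift`,
`Subspace.forall_mem_dualAnnihilator_apply_eq_zero_iff`, `Module.forall_dual_apply_eq_zero_iff`, `Subgroup.closure_induction`.
Dedup `rg "of_hasWeakDeriv|ad_compat_of|conjCoeff"`: no hits.

## References

* A. Borel, N. Wallach, *Continuous cohomology, discrete subgroups, and representations of reductive groups*, 2nd ed.,
  AMS (2000), 0 §2.5 (held). [BorelWallach2000]
* A. W. Knapp, D. A. Vogan, *Cohomological Induction and Unitary Representations*, Princeton (1995), §I.4. [KnappVogan1995]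
* N. R. Wallach, *Real Reductive Groups I*, Academic Press (1988), §3.3.1.
-/

-- Mathlib idiom (commutator bracket, `Mathlib/Algebra/Lie/OfAssociative.lean`); `respectTransparency` as in
-- `GKModulesSmoothVectorsProofs` (the scoped `L^∞`-operator normed structure on matrices)
attribute [local instance 100] LieRing.ofAssociativeRing
set_option backward.isDefEq.respectTransparency false

open scoped MatrixGroups Matrix Topology Matrix.Norms.Operator
open Module

noncomputable section

namespace Literature.NumberTheory.Automorphic

variable {A : Type*} [NormedCommRing A] [NormedAlgebra ℝ A] [NormedAlgebra ℚ A] [CompleteSpace A]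
  [StarRing A] [StarModule ℝ A] [ContinuousStar A] {N : Type*} [Fintype N] [DecidableEq N]
  {G : RealMatrixGroup A N}
  {V : Type*} [AddCommGroup V] [Module ℂ V]
  {ρK : Representation ℂ G.maximalCompact V} {ρ𝔤 : G.lie →ₗ⁅ℝ⁆ Module.End ℂ V}

namespace IsGKModule

/-! ## §1 One-parameter subgroups of `K`: group law and weak derivatives -/

/-- `expK (−t Y) = (expK (t Y))⁻¹` (one-parameter subgroup). [cite: Knapp2002, 0 §2 Prop. 0.11 (c)] -/
theorem expK_neg_smul (t : ℝ) (Y : G.compactLie) : G.expK ((-t) • Y) = (G.expK (t • Y))⁻¹ := by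
  rw [eq_inv_iff_mul_eq_one, ← RealMatrixGroup.expK_add_smul, neg_add_cancel,
    RealMatrixGroup.expK_zero_smul]

/-- A `K`-stable subspace is `𝔨`-stable, given only the weak derivative along `𝔨`: for `ℓ` in the annihilator of
`U`, `ℓ (ρK (exp tY) u) = 0` identically, so `ℓ (ρ𝔤 Y u) = 0`, and `U = U^{⊥⊥}` (Wallach §3.3.1). [cite: BorelWallach2000, 0 §2.5] -/
theorem apply_mem_of_K_stable_of_hasWeakDeriv
    (hD : ∀ (Y : G.compactLie) (v : V) (ℓ : Module.Dual ℂ V),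
      HasDerivAt (fun t : ℝ ↦ ℓ (ρK (G.expK (t • Y)) v)) (ℓ (ρ𝔤 (LieSubalgebra.inclusion G.compactLie_le_lie Y) v)) 0)
    (Y : G.compactLie) {U : Submodule ℂ V} (hU : ∀ (k : G.maximalCompact), ∀ u ∈ U, ρK k u ∈ U)
    {u : V} (hu : u ∈ U) :
    ρ𝔤 (LieSubalgebra.inclusion G.compactLie_le_lie Y) u ∈ U := by
  refine (Subspace.forall_mem_dualAnnihilator_apply_eq_zero_iff U _).1 fun ℓ hℓ ↦ ?_
  have h1 := hD Y u ℓ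
  have h2 : HasDerivAt (fun t : ℝ ↦ ℓ (ρK (G.expK (t • Y)) u)) 0 0 := by
    refine (hasDerivAt_const (0 : ℝ) (0 : ℂ)).congr_of_eventuallyEq
      (Filter.Eventually.of_forall fun t ↦ ?_)
    exact (Submodule.mem_dualAnnihilator ℓ).1 hℓ _ (hU _ u hu)
  exact h1.unique h2

omit [StarModule ℝ A] [ContinuousStar A] in
/-- The span of the `K`-orbit of `v` contains `v`. [cite: BorelWallach2000, 0 §2.5] -/
theorem mem_span_orbit_self (v : V) :
    v ∈ Submodule.span ℂ (Set.range fun k : G.maximalCompact ↦ ρK k v) :=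
  Submodule.subset_span ⟨1, show ρK 1 v = v by rw [map_one, Module.End.one_apply]⟩

/-! ## §2 `Ad`-compatible elements form a subgroup -/

omit [StarModule ℝ A] [ContinuousStar A] in
/-- `Ad`-compatibility at `1`. [cite: BorelWallach2000, 0 §2.5] -/
theorem ad_compat_one (X : G.lie) :
    ρK 1 ∘ₗ ρ𝔤 X ∘ₗ ρK (1 : G.maximalCompact)⁻¹ =
      ρ𝔤 (G.Ad (Subgroup.inclusion G.maximalCompact_le_carrier 1) X) := by
  rw [inv_one, map_one, map_one, RealMatrixGroup.Ad_one, LieHom.id_apply]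
  rfl

omit [StarModule ℝ A] [ContinuousStar A] in
/-- `Ad`-compatibility is multiplicative in `k` (`Ad (k k') = Ad k ∘ Ad k'`). [cite: BorelWallach2000, 0 §2.5] -/
theorem ad_compat_mul {k k' : G.maximalCompact}
    (hk : ∀ X : G.lie, ρK k ∘ₗ ρ𝔤 X ∘ₗ ρK k⁻¹ =
      ρ𝔤 (G.Ad (Subgroup.inclusion G.maximalCompact_le_carrier k) X))
    (hk' : ∀ X : G.lie, ρK k' ∘ₗ ρ𝔤 X ∘ₗ ρK k'⁻¹ =
      ρ𝔤 (G.Ad (Subgroup.inclusion G.maximalCompact_le_carrier k') X)) (X : G.lie) :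
    ρK (k * k') ∘ₗ ρ𝔤 X ∘ₗ ρK (k * k')⁻¹ =
      ρ𝔤 (G.Ad (Subgroup.inclusion G.maximalCompact_le_carrier (k * k')) X) := by
  rw [show Subgroup.inclusion G.maximalCompact_le_carrier (k * k') =
      Subgroup.inclusion G.maximalCompact_le_carrier k * Subgroup.inclusion G.maximalCompact_le_carrier k'
      from map_mul _ k k', RealMatrixGroup.Ad_mul, LieHom.comp_apply,
    ← hk (G.Ad (Subgroup.inclusion G.maximalCompact_le_carrier k') X), ← hk' X, mul_inv_rev, map_mul,
    map_mul]
  refine LinearMap.ext fun v ↦ ?_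
  simp only [LinearMap.coe_comp, Function.comp_apply, Module.End.mul_apply]

omit [StarModule ℝ A] [ContinuousStar A] in
/-- `Ad`-compatibility passes to inverses (apply it to `Ad k⁻¹ X`). [cite: BorelWallach2000, 0 §2.5] -/
theorem ad_compat_inv {k : G.maximalCompact}
    (hk : ∀ X : G.lie, ρK k ∘ₗ ρ𝔤 X ∘ₗ ρK k⁻¹ =
      ρ𝔤 (G.Ad (Subgroup.inclusion G.maximalCompact_le_carrier k) X)) (X : G.lie) :
    ρK k⁻¹ ∘ₗ ρ𝔤 X ∘ₗ ρK k⁻¹⁻¹ =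
      ρ𝔤 (G.Ad (Subgroup.inclusion G.maximalCompact_le_carrier k⁻¹) X) := by
  have h := hk (G.Ad (Subgroup.inclusion G.maximalCompact_le_carrier k⁻¹) X)
  have e : G.Ad (Subgroup.inclusion G.maximalCompact_le_carrier k)
      (G.Ad (Subgroup.inclusion G.maximalCompact_le_carrier k⁻¹) X) = X := by
    have := DFunLike.congr_fun (RealMatrixGroup.Ad_mul G (Subgroup.inclusion G.maximalCompact_le_carrier k)
      (Subgroup.inclusion G.maximalCompact_le_carrier k⁻¹)) X
    rw [LieHom.comp_apply, ← map_mul, mul_inv_cancel, map_one, RealMatrixGroup.Ad_one,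
      LieHom.id_apply] at this
    exact this.symm
  rw [e] at h
  have hkk : ∀ w, ρK k⁻¹ (ρK k w) = w := fun w ↦ by
    rw [← Module.End.mul_apply, ← map_mul, inv_mul_cancel, map_one, Module.End.one_apply]
  rw [inv_inv, ← h]
  refine LinearMap.ext fun v ↦ ?_
  simp only [LinearMap.coe_comp, Function.comp_apply, hkk]

/-! ## §3 The derivative of the conjugated coefficient vanishes; `Ad`-compatibility on `⟨exp 𝔨⟩` -/

section Deriv

variable [FiniteDimensional ℝ A]
  (hF : ∀ v : V, FiniteDimensional ℂ (Submodule.span ℂ (Set.range fun k : G.maximalCompact ↦ ρK k v)))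
  (hD : ∀ (Y : G.compactLie) (v : V) (ℓ : Module.Dual ℂ V),
    HasDerivAt (fun t : ℝ ↦ ℓ (ρK (G.expK (t • Y)) v)) (ℓ (ρ𝔤 (LieSubalgebra.inclusion G.compactLie_le_lie Y) v)) 0)
include hF hD

/-- **Core computation.** Given `K`-finiteness and the weak derivative along `𝔨`, for `Y ∈ 𝔨`, `X ∈ 𝔤`, `v ∈ V`
and a functional `ℓ`, the coefficient `s ↦ ℓ (ρK (exp sY)⁻¹ (ρ𝔤 (Ad (exp sY) X) (ρK (exp sY) v)))` has derivative
`0` at `s = 0`: in coordinates of the (finite-dimensional, `K`- hence `𝔨`-stable) `K`-span of `v` and of `𝔤` it is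
a finite sum of triple products, and the three partial derivatives add up to
`ℓ ((ρ𝔤 X ρ𝔤 Y + ρ𝔤 ⁅Y, X⁆ − ρ𝔤 Y ρ𝔤 X) v) = 0` because `ρ𝔤` is a Lie homomorphism.
[cite: BorelWallach2000, 0 §2.5] -/
theorem hasDerivAt_conjCoeff_zero
    (Y : G.compactLie) (X : G.lie) (v : V) (ℓ : Module.Dual ℂ V) :
    HasDerivAt (fun s : ℝ ↦ ℓ (ρK (G.expK (s • Y))⁻¹
      (ρ𝔤 (G.Ad (Subgroup.inclusion G.maximalCompact_le_carrier (G.expK (s • Y))) X) (ρK (G.expK (s • Y)) v)))) 0 0 := by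
  set U : Submodule ℂ V := Submodule.span ℂ (Set.range fun k : G.maximalCompact ↦ ρK k v) with hUdef
  haveI : FiniteDimensional ℂ U := hF v
  set Yg : G.lie := LieSubalgebra.inclusion G.compactLie_le_lie Y with hYg
  set Ys : G.lie.toSubmodule := ⟨(Y : Matrix N N A), G.compactLie_le_lie Y.2⟩ with hYs
  let ι : G.lie.toSubmodule →ₗ[ℝ] G.lie :=
    { toFun := fun Z ↦ ⟨(Z : Matrix N N A), Z.2⟩
      map_add' := fun _ _ ↦ rfl
      map_smul' := fun _ _ ↦ rfl }
  set Xs : G.lie.toSubmodule := ⟨(X : Matrix N N A), X.2⟩ with hXs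
  have hιX : ι Xs = X := rfl
  set b := Module.finBasis ℂ U with hb
  set e : Fin (Module.finrank ℂ U) → Module.Dual ℂ V := fun i ↦ Subspace.dualLift U (b.coord i) with he
  have he_apply : ∀ (i) (u : V) (hu : u ∈ U), e i u = b.repr ⟨u, hu⟩ i := fun i u hu ↦ by
    rw [he]; exact Subspace.dualLift_of_mem hu
  have hrecU : ∀ (T : V →ₗ[ℂ] V) (u : V), u ∈ U → T u = ∑ i, e i u • T (b i : V) := by
    intro T u hu
    have h := b.sum_repr ⟨u, hu⟩
    have h' : u = ∑ i, b.repr ⟨u, hu⟩ i • (b i : V) := by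
      conv_lhs => rw [show u = ((⟨u, hu⟩ : U) : V) from rfl, ← h]
      simp only [Submodule.coe_sum, Submodule.coe_smul]
    conv_lhs => rw [h']
    simp only [map_sum, map_smul]
    exact Finset.sum_congr rfl fun i _ ↦ by rw [he_apply i u hu]
  have hrecUℓ : ∀ (T : V →ₗ[ℂ] V) (μ : Module.Dual ℂ V) (u : V), u ∈ U →
      μ (T u) = ∑ i, e i u * μ (T (b i : V)) := by
    intro T μ u hu
    rw [hrecU T u hu, map_sum]
    exact Finset.sum_congr rfl fun i _ ↦ by rw [map_smul, smul_eq_mul]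
  have hrecg : ∀ Z : G.lie.toSubmodule,
      ρ𝔤 (ι Z) = ∑ j, ExpOrbit.coordS G j Z • ρ𝔤 (ι (ExpOrbit.basisS G j)) := by
    intro Z
    conv_lhs => rw [← (ExpOrbit.basisS G).sum_repr Z]
    simp only [map_sum, map_smul, ExpOrbit.coordS_apply]
  have hrecgℓ : ∀ (Z : G.lie.toSubmodule) (w : V) (μ : Module.Dual ℂ V),
      μ (ρ𝔤 (ι Z) w) = ∑ j, ExpOrbit.coordS G j Z • μ (ρ𝔤 (ι (ExpOrbit.basisS G j)) w) := by
    intro Z w μ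
    rw [hrecg Z]
    simp only [LinearMap.sum_apply, LinearMap.smul_apply, map_sum, LinearMap.map_smul_of_tower]
  have ha : ∀ i, HasDerivAt (fun s : ℝ ↦ e i (ρK (G.expK (s • Y)) v)) (e i (ρ𝔤 Yg v)) 0 :=
    fun i ↦ hD Y v (e i)
  have hc : ∀ j, HasDerivAt (fun s : ℝ ↦ ExpOrbit.coordS G j (G.AdCLM (G.expS (s • Ys)) Xs))
      (ExpOrbit.coordS G j (G.brS Ys Xs)) 0 :=
    fun j ↦ (ExpOrbit.coordS G j).hasFDerivAt.comp_hasDerivAt 0 (G.hasDerivAt_AdCLM_expS_smul Ys Xs)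
  have hd : ∀ w : V, HasDerivAt (fun s : ℝ ↦ ℓ (ρK (G.expK (s • Y))⁻¹ w)) (-ℓ (ρ𝔤 Yg w)) 0 := by
    intro w
    have h := hD (-Y) w ℓ
    have h1 : (fun t : ℝ ↦ ℓ (ρK (G.expK (t • -Y)) w)) = fun s : ℝ ↦ ℓ (ρK (G.expK (s • Y))⁻¹ w) := by
      funext s
      rw [smul_neg, ← neg_smul, expK_neg_smul]
    have h2 : ℓ (ρ𝔤 (LieSubalgebra.inclusion G.compactLie_le_lie (-Y)) w) = -ℓ (ρ𝔤 Yg w) := by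
      rw [map_neg, map_neg, LinearMap.neg_apply, map_neg]
    rw [h1, h2] at h
    exact h
  have hAd : ∀ s : ℝ, G.Ad (Subgroup.inclusion G.maximalCompact_le_carrier (G.expK (s • Y))) X =
      ι (G.AdCLM (G.expS (s • Ys)) Xs) := fun s ↦ Subtype.ext rfl
  have hfun : (fun s : ℝ ↦ ℓ (ρK (G.expK (s • Y))⁻¹
      (ρ𝔤 (G.Ad (Subgroup.inclusion G.maximalCompact_le_carrier (G.expK (s • Y))) X) (ρK (G.expK (s • Y)) v)))) =
      fun s : ℝ ↦ ∑ i, e i (ρK (G.expK (s • Y)) v) *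
        ∑ j, ExpOrbit.coordS G j (G.AdCLM (G.expS (s • Ys)) Xs) •
          ℓ (ρK (G.expK (s • Y))⁻¹ (ρ𝔤 (ι (ExpOrbit.basisS G j)) (b i : V))) := by
    funext s
    have hu : ρK (G.expK (s • Y)) v ∈ U := GKTensor.kOrbitSpan_stable G ρK v _ (mem_span_orbit_self v)
    have hU := hrecUℓ (ρ𝔤 (G.Ad (Subgroup.inclusion G.maximalCompact_le_carrier (G.expK (s • Y))) X))
      (ℓ ∘ₗ ρK (G.expK (s • Y))⁻¹) _ hu
    simp only [LinearMap.coe_comp, Function.comp_apply] at hU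
    rw [hU]
    refine Finset.sum_congr rfl fun i _ ↦ ?_
    have h := hrecgℓ (G.AdCLM (G.expS (s • Ys)) Xs) (b i : V) (ℓ ∘ₗ ρK (G.expK (s • Y))⁻¹)
    simp only [LinearMap.coe_comp, Function.comp_apply] at h ⊢
    rw [hAd s, h]
  rw [hfun]
  have hsum := HasDerivAt.fun_sum (u := Finset.univ) fun i _ ↦
    (ha i).fun_mul (HasDerivAt.fun_sum (u := Finset.univ) fun j _ ↦
      (hc j).fun_smul (hd (ρ𝔤 (ι (ExpOrbit.basisS G j)) (b i : V))))
  have h0K : G.expK ((0 : ℝ) • Y) = 1 := RealMatrixGroup.expK_zero_smul Y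
  have h0S : G.AdCLM (G.expS ((0 : ℝ) • Ys)) Xs = Xs := by
    rw [zero_smul, RealMatrixGroup.expS_zero, RealMatrixGroup.AdCLM_one, ContinuousLinearMap.id_apply]
  simp only [h0K, h0S, inv_one, map_one, Module.End.one_apply] at hsum
  have hbr : ι (G.brS Ys Xs) = ⁅Yg, X⁆ := by
    apply Subtype.ext
    rw [LieSubalgebra.coe_bracket, Ring.lie_def]
    rfl
  have h1 : ∀ i, ∑ j, ExpOrbit.coordS G j Xs • ℓ (ρ𝔤 (ι (ExpOrbit.basisS G j)) (b i : V)) =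
      ℓ (ρ𝔤 X (b i : V)) := fun i ↦ by rw [← hrecgℓ, hιX]
  have h2 : ∀ i, ∑ j, ExpOrbit.coordS G j (G.brS Ys Xs) • ℓ (ρ𝔤 (ι (ExpOrbit.basisS G j)) (b i : V)) =
      ℓ (ρ𝔤 ⁅Yg, X⁆ (b i : V)) := fun i ↦ by rw [← hrecgℓ, hbr]
  have h3 : ∀ i, ∑ j, ExpOrbit.coordS G j Xs • -ℓ (ρ𝔤 Yg (ρ𝔤 (ι (ExpOrbit.basisS G j)) (b i : V))) =
      -ℓ (ρ𝔤 Yg (ρ𝔤 X (b i : V))) := fun i ↦ by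
    have h := hrecgℓ Xs (b i : V) (ℓ ∘ₗ ρ𝔤 Yg)
    simp only [LinearMap.coe_comp, Function.comp_apply, hιX] at h
    rw [h, ← Finset.sum_neg_distrib]
    exact Finset.sum_congr rfl fun j _ ↦ by rw [smul_neg]
  have hv : v ∈ U := mem_span_orbit_self v
  have hYv : ρ𝔤 Yg v ∈ U :=
    apply_mem_of_K_stable_of_hasWeakDeriv hD Y (fun k u hu ↦ GKTensor.kOrbitSpan_stable G ρK v k hu) hv
  have h4 : ∑ i, e i v * ℓ (ρ𝔤 ⁅Yg, X⁆ (b i : V)) = ℓ (ρ𝔤 ⁅Yg, X⁆ v) :=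
    (hrecUℓ (ρ𝔤 ⁅Yg, X⁆) ℓ v hv).symm
  have h5 : ∑ i, e i v * -ℓ (ρ𝔤 Yg (ρ𝔤 X (b i : V))) = -ℓ (ρ𝔤 Yg (ρ𝔤 X v)) := by
    have h := hrecUℓ (ρ𝔤 X) (ℓ ∘ₗ ρ𝔤 Yg) v hv
    simp only [LinearMap.coe_comp, Function.comp_apply] at h
    rw [h, ← Finset.sum_neg_distrib]
    exact Finset.sum_congr rfl fun i _ ↦ by rw [mul_neg]
  have h6 : ∑ i, e i (ρ𝔤 Yg v) * ℓ (ρ𝔤 X (b i : V)) = ℓ (ρ𝔤 X (ρ𝔤 Yg v)) :=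
    (hrecUℓ (ρ𝔤 X) ℓ (ρ𝔤 Yg v) hYv).symm
  have hzero : ℓ (ρ𝔤 X (ρ𝔤 Yg v)) + (-ℓ (ρ𝔤 Yg (ρ𝔤 X v)) + ℓ (ρ𝔤 ⁅Yg, X⁆ v)) = 0 := by
    rw [LieHom.map_lie, Ring.lie_def, LinearMap.sub_apply, Module.End.mul_apply, Module.End.mul_apply,
      map_sub]
    ring
  refine hsum.congr_deriv ?_
  simp only [Finset.sum_add_distrib, h1, h2, h3, mul_add, h4, h5, h6]
  linear_combination hzero

/-- **The conjugated coefficient is constant**: with `k_t = exp tY` (`Y ∈ 𝔨`),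
`ℓ (ρK k_t⁻¹ (ρ𝔤 (Ad k_t X) (ρK k_t v))) = ℓ (ρ𝔤 X v)` for all `t` — the derivative at `t` is the derivative
at `0` for the data `(Ad k_t X, ρK k_t v, ℓ ∘ ρK k_t⁻¹)` (one-parameter group law), which vanishes
(`hasDerivAt_conjCoeff_zero`). [cite: BorelWallach2000, 0 §2.5] -/
theorem conjCoeff_eq
    (Y : G.compactLie) (X : G.lie) (v : V) (ℓ : Module.Dual ℂ V) (t : ℝ) :
    ℓ (ρK (G.expK (t • Y))⁻¹ (ρ𝔤 (G.Ad (Subgroup.inclusion G.maximalCompact_le_carrier (G.expK (t • Y))) X)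
      (ρK (G.expK (t • Y)) v))) = ℓ (ρ𝔤 X v) := by
  set g : ℝ → ℂ := fun t ↦ ℓ (ρK (G.expK (t • Y))⁻¹
    (ρ𝔤 (G.Ad (Subgroup.inclusion G.maximalCompact_le_carrier (G.expK (t • Y))) X) (ρK (G.expK (t • Y)) v))) with hg
  have hderiv : ∀ t : ℝ, HasDerivAt g 0 t := by
    intro t
    set kt := G.expK (t • Y) with hkt
    have h0 := hasDerivAt_conjCoeff_zero hF hD Y
      (G.Ad (Subgroup.inclusion G.maximalCompact_le_carrier kt) X) (ρK kt v) (ℓ ∘ₗ ρK kt⁻¹)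
    have h1 : (fun s : ℝ ↦ (ℓ ∘ₗ ρK kt⁻¹) (ρK (G.expK (s • Y))⁻¹
        (ρ𝔤 (G.Ad (Subgroup.inclusion G.maximalCompact_le_carrier (G.expK (s • Y)))
          (G.Ad (Subgroup.inclusion G.maximalCompact_le_carrier kt) X)) (ρK (G.expK (s • Y)) (ρK kt v))))) =
        fun s : ℝ ↦ g (t + s) := by
      funext s
      simp only [hg, LinearMap.coe_comp, Function.comp_apply]
      rw [add_comm, RealMatrixGroup.expK_add_smul, mul_inv_rev, map_mul, map_mul, map_mul,
        RealMatrixGroup.Ad_mul]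
      rfl
    rw [h1] at h0
    have h2 := HasDerivAt.comp_sub_const (f := fun s : ℝ ↦ g (t + s)) t t (by rwa [sub_self])
    refine h2.congr_of_eventuallyEq (Filter.Eventually.of_forall fun u ↦ ?_)
    simp only [add_sub_cancel]
  have hconst := is_const_of_deriv_eq_zero (fun t ↦ (hderiv t).differentiableAt)
    (fun t ↦ (hderiv t).deriv) t 0
  have hg0 : g 0 = ℓ (ρ𝔤 X v) := by
    simp only [hg, RealMatrixGroup.expK_zero_smul, inv_one, map_one, Module.End.one_apply,
      RealMatrixGroup.Ad_one, LieHom.id_apply]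
  rw [← hg0, ← hconst]

/-- **`Ad`-compatibility along `exp 𝔨`**: `ρK k ∘ ρ𝔤 X ∘ ρK k⁻¹ = ρ𝔤 (Ad k X)` for `k = exp Y`, `Y ∈ 𝔨`, from
`K`-finiteness and the weak derivative alone (functionals separate points). [cite: BorelWallach2000, 0 §2.5] -/
theorem ad_compat_expK
    (Y : G.compactLie) (X : G.lie) :
    ρK (G.expK Y) ∘ₗ ρ𝔤 X ∘ₗ ρK (G.expK Y)⁻¹ =
      ρ𝔤 (G.Ad (Subgroup.inclusion G.maximalCompact_le_carrier (G.expK Y)) X) := by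
  have h1 : G.expK Y = G.expK ((1 : ℝ) • Y) := by rw [one_smul]
  set k := G.expK Y with hk
  have h2 : ρK k⁻¹ ∘ₗ ρ𝔤 (G.Ad (Subgroup.inclusion G.maximalCompact_le_carrier k) X) ∘ₗ ρK k = ρ𝔤 X := by
    refine LinearMap.ext fun v ↦ ?_
    rw [← sub_eq_zero, ← forall_dual_apply_eq_zero_iff ℂ]
    intro ℓ
    rw [map_sub, sub_eq_zero, LinearMap.coe_comp, LinearMap.coe_comp, Function.comp_apply,
      Function.comp_apply, h1]
    exact conjCoeff_eq hF hD Y X v ℓ 1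
  have h3 : ρK k ∘ₗ (ρK k⁻¹ ∘ₗ ρ𝔤 (G.Ad (Subgroup.inclusion G.maximalCompact_le_carrier k) X) ∘ₗ ρK k) ∘ₗ
      ρK k⁻¹ = ρ𝔤 (G.Ad (Subgroup.inclusion G.maximalCompact_le_carrier k) X) := by
    have hkk : ∀ w, ρK k (ρK k⁻¹ w) = w := fun w ↦ by
      rw [← Module.End.mul_apply, ← map_mul, mul_inv_cancel, map_one, Module.End.one_apply]
    refine LinearMap.ext fun v ↦ ?_
    simp only [LinearMap.coe_comp, Function.comp_apply, hkk]
  rw [h2] at h3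
  exact h3

/-- **`Ad`-compatibility on the subgroup generated by `exp 𝔨`.** [cite: BorelWallach2000, 0 §2.5] -/
theorem ad_compat_of_mem_closure_expK
    {k : G.maximalCompact} (hk : k ∈ Subgroup.closure (Set.range G.expK)) (X : G.lie) :
    ρK k ∘ₗ ρ𝔤 X ∘ₗ ρK k⁻¹ = ρ𝔤 (G.Ad (Subgroup.inclusion G.maximalCompact_le_carrier k) X) := by
  induction hk using Subgroup.closure_induction generalizing X with
  | mem k hk =>
    obtain ⟨Y, rfl⟩ := hk
    exact ad_compat_expK hF hD Y X
  | one => exact ad_compat_one X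
  | mul k k' _ _ ih ih' => exact ad_compat_mul ih ih' X
  | inv k _ ih => exact ad_compat_inv ih X

end Deriv

/-! ## §4 The constructors -/

/-- **Constructor: `Ad`-compatibility is automatic when `K = ⟨exp 𝔨⟩`.** If the subgroup generated by `exp 𝔨` is
all of `K` (e.g. `K` connected compact), then `K`-finiteness, weak continuity and the weak derivative along `𝔨`
already make `(ρK, ρ𝔤)` a `(𝔤, K)`-module. [cite: BorelWallach2000, 0 §2.5]
[cite: KnappVogan1995, §I.4 (1.64)–(1.65)] -/
theorem of_hasWeakDeriv [FiniteDimensional ℝ A]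
    (hK : Subgroup.closure (Set.range G.expK) = ⊤)
    (kFinite : ∀ v : V, FiniteDimensional ℂ (Submodule.span ℂ (Set.range fun k : G.maximalCompact ↦ ρK k v)))
    (weaklyContinuous : ∀ (v : V) (ℓ : Module.Dual ℂ V), Continuous fun k : G.maximalCompact ↦ ℓ (ρK k v))
    (hasWeakDeriv : ∀ (Y : G.compactLie) (v : V) (ℓ : Module.Dual ℂ V),
      HasDerivAt (fun t : ℝ ↦ ℓ (ρK (G.expK (t • Y)) v)) (ℓ (ρ𝔤 (LieSubalgebra.inclusion G.compactLie_le_lie Y) v)) 0) :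
    IsGKModule G ρK ρ𝔤 where
  kFinite := kFinite
  weaklyContinuous := weaklyContinuous
  ad_compat k X := ad_compat_of_mem_closure_expK kFinite hasWeakDeriv (hK ▸ Subgroup.mem_top k) X
  hasWeakDeriv := hasWeakDeriv

/-- **Constructor, surjective-exponential form**: if every `k ∈ K` is `exp Y` for some `Y ∈ 𝔨` (e.g.
`K = U(p) × U(q) ⊂ U(p,q)`, `K = U(1) × U(1) ⊂ U(1,1)`), then `K`-finiteness, weak continuity and the weak derivative
along `𝔨` make `(ρK, ρ𝔤)` a `(𝔤, K)`-module. [cite: BorelWallach2000, 0 §2.5] -/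
theorem of_hasWeakDeriv_of_expK_surjective [FiniteDimensional ℝ A]
    (hK : ∀ k : G.maximalCompact, ∃ Y : G.compactLie, G.expK Y = k)
    (kFinite : ∀ v : V, FiniteDimensional ℂ (Submodule.span ℂ (Set.range fun k : G.maximalCompact ↦ ρK k v)))
    (weaklyContinuous : ∀ (v : V) (ℓ : Module.Dual ℂ V), Continuous fun k : G.maximalCompact ↦ ℓ (ρK k v))
    (hasWeakDeriv : ∀ (Y : G.compactLie) (v : V) (ℓ : Module.Dual ℂ V),
      HasDerivAt (fun t : ℝ ↦ ℓ (ρK (G.expK (t • Y)) v)) (ℓ (ρ𝔤 (LieSubalgebra.inclusion G.compactLie_le_lie Y) v)) 0) :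
    IsGKModule G ρK ρ𝔤 := by
  refine of_hasWeakDeriv ?_ kFinite weaklyContinuous hasWeakDeriv
  refine top_le_iff.mp fun k _ ↦ ?_
  obtain ⟨Y, rfl⟩ := hK k
  exact Subgroup.subset_closure ⟨Y, rfl⟩

end IsGKModule

end Literature.NumberTheory.Automorphic
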